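import Summits.CriticalPhenomena.PercolationContinuityZ3.Theorems.SahiMasterFamilyFCombFace
import Summits.CriticalPhenomena.PercolationContinuityZ3.Theorems.SahiMasterFamilyFCombThreshold
import Mathlib.Tactic.Linarith
import HarnessLib

/-!
# The master-family `F`-inequality for THRESHOLD third events, every product measure

Support file (cell `prim-bnk`, seat bnk-2 gen 20; `--supports stmt-CriticalPhenomena-4575`; memo
`run/shared/lean/prim/prim-l12/FROM-prim-bnk-2-g20-CP-CERTIFICATES.md`, Theorem 4 + §7(0)).  No definition, no `sorry`, standard axioms.

**THEOREM (`F_nonneg_threshold`).**  For every `n, t`, every parameter vector `p ∈ [0,1]^n` (product measure on `Fin n → Bool` with weights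
`w_p(s) = ∏ i (p i if s i else 1 − p i)`, `μ_p X = Σ_s w_p(s)[X s]`) and all monotone `A, B : (Fin n → Bool) → Bool`, with the threshold third event
`G = {x : #{i : x i} ≥ t}` (majority when `n = 2t − 1`):
`(1 + μ_pG)·μ_p(A∩B∩G) − μ_pG·μ_p(A∩B) − μ_p(A∩G)·μ_p(B∩G) ≥ 0`
— the conjectured inequality `F(A,B;G) ≥ 0` of `prim-master-conj` (POINTWISE §21; 0-minor core of the MD₃ programme, p312646) for ALL threshold
third events in every dimension.  Proof: face expansion (`F_nonneg_of_face_combs_nonneg`) + re-indexing (`face_comb_sum_eq`) + the comb theorem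
`comb_sum_nonneg_of_peelableNP` / `peelableNP_threshold` (restrictions of thresholds to faces are thresholds).  The statement is in the
Boolean-function encoding of events; the translation to the tree's `Set (Set κ)` / `bernoulliWeight` vocabulary is routine and not done here.
HONEST FRAMING: threshold `G` only; `F ≥ 0` for general `G` remains OPEN. [this work]
-/

namespace Summit.CriticalPhenomena.PercolationContinuityZ3.Theorems

namespace SahiFComb

open Finset

variable {n m : ℕ}

/-- `F ≥ 0` for a third event that is (propositionally) the threshold event `{x : #{i : x i} ≥ t}` — opaque-`G` form. [this work] -/
theorem F_nonneg_of_eq_threshold (n t : ℕ) (p : Fin n → ℝ) (hp0 : ∀ i, 0 ≤ p i) (hp1 : ∀ i, p i ≤ 1)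
    (A B G : (Fin n → Bool) → Bool) (hA : Monotone A) (hB : Monotone B)
    (hG : G = fun s => decide (t ≤ ∑ i, Bool.toNat (s i))) :
    0 ≤ (1 + ∑ s : Fin n → Bool, (∏ i, (if s i then p i else 1 - p i)) * (Bool.toNat (G s) : ℝ))
        * (∑ s : Fin n → Bool, (∏ i, (if s i then p i else 1 - p i)) * (Bool.toNat (A s && B s && G s) : ℝ))
      - (∑ s : Fin n → Bool, (∏ i, (if s i then p i else 1 - p i)) * (Bool.toNat (G s) : ℝ))
        * (∑ s : Fin n → Bool, (∏ i, (if s i then p i else 1 - p i)) * (Bool.toNat (A s && B s) : ℝ))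
      - (∑ s : Fin n → Bool, (∏ i, (if s i then p i else 1 - p i)) * (Bool.toNat (A s && G s) : ℝ))
        * (∑ s : Fin n → Bool, (∏ i, (if s i then p i else 1 - p i)) * (Bool.toNat (B s && G s) : ℝ)) := by
  refine F_nonneg_of_face_combs_nonneg p hp0 hp1 A B G (fun d z => ?_)
  by_cases hz : ∀ i, d i = true → z i = false
  · -- re-index the face by `Fin m`
    obtain ⟨e⟩ : Nonempty (Fin (Fintype.card {i : Fin n // d i = true}) ≃ {i : Fin n // d i = true}) :=
      ⟨(Fintype.equivFin _).symm⟩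
    rw [face_comb_sum_eq A B G d z e hz]
    -- the restricted third event is again a threshold event
    have hG' : (fun y : Fin (Fintype.card {i : Fin n // d i = true}) → Bool =>
          G (fun i => if h : d i = true then y (e.symm ⟨i, h⟩) else z i))
        = (fun y => decide ((t - ∑ i : {i : Fin n // ¬ d i = true}, Bool.toNat (z i.1)) ≤ ∑ j, Bool.toNat (y j))) := by
      funext y
      rw [hG]
      show decide (t ≤ ∑ i, Bool.toNat (if h : d i = true then y (e.symm ⟨i, h⟩) else z i)) = _
      rw [cnt_emb d z e y]
      by_cases h : t - (∑ i : {i : Fin n // ¬ d i = true}, Bool.toNat (z i.1)) ≤ ∑ j, Bool.toNat (y j)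
      · have h2 : t ≤ (∑ j, Bool.toNat (y j)) + ∑ i : {i : Fin n // ¬ d i = true}, Bool.toNat (z i.1) := by omega
        rw [decide_eq_true h2, decide_eq_true h]
      · have h2 : ¬ t ≤ (∑ j, Bool.toNat (y j)) + ∑ i : {i : Fin n // ¬ d i = true}, Bool.toNat (z i.1) := by omega
        rw [decide_eq_false h2, decide_eq_false h]
    have hP : PeelableNP (Fintype.card {i : Fin n // d i = true})
        (fun y => G (fun i => if h : d i = true then y (e.symm ⟨i, h⟩) else z i)) := by
      rw [hG']; exact peelableNP_threshold _ _
    have hA' : Monotone (fun y : Fin (Fintype.card {i : Fin n // d i = true}) → Bool =>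
        A (fun i => if h : d i = true then y (e.symm ⟨i, h⟩) else z i)) :=
      fun y y' hy => hA (emb_mono d z e hy)
    have hB' : Monotone (fun y : Fin (Fintype.card {i : Fin n // d i = true}) → Bool =>
        B (fun i => if h : d i = true then y (e.symm ⟨i, h⟩) else z i)) :=
      fun y y' hy => hB (emb_mono d z e hy)
    have key := comb_sum_nonneg_of_peelableNP hP _ _ hA' hB'
    exact_mod_cast key
  · rw [← Finset.sum_filter, fiber_eq_empty d z hz, Finset.sum_empty]

/-- **THEOREM (`F ≥ 0` for threshold third events).**  For all `n t`, every `p ∈ [0,1]^n`, and all monotone `A, B` on `Fin n → Bool`, with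
the threshold (for `n = 2t−1`: majority) third event `G = {x : #{i : x i} ≥ t}`:
`(1 + μ_pG)·μ_p(A∩B∩G) − μ_pG·μ_p(A∩B) − μ_p(A∩G)·μ_p(B∩G) ≥ 0`. [this work] -/
theorem F_nonneg_threshold (n t : ℕ) (p : Fin n → ℝ) (hp0 : ∀ i, 0 ≤ p i) (hp1 : ∀ i, p i ≤ 1)
    (A B : (Fin n → Bool) → Bool) (hA : Monotone A) (hB : Monotone B) :
    0 ≤ (1 + ∑ s : Fin n → Bool, (∏ i, (if s i then p i else 1 - p i)) * (Bool.toNat (decide (t ≤ ∑ i, Bool.toNat (s i))) : ℝ))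
        * (∑ s : Fin n → Bool, (∏ i, (if s i then p i else 1 - p i))
            * (Bool.toNat (A s && B s && decide (t ≤ ∑ i, Bool.toNat (s i))) : ℝ))
      - (∑ s : Fin n → Bool, (∏ i, (if s i then p i else 1 - p i)) * (Bool.toNat (decide (t ≤ ∑ i, Bool.toNat (s i))) : ℝ))
        * (∑ s : Fin n → Bool, (∏ i, (if s i then p i else 1 - p i)) * (Bool.toNat (A s && B s) : ℝ))
      - (∑ s : Fin n → Bool, (∏ i, (if s i then p i else 1 - p i))
            * (Bool.toNat (A s && decide (t ≤ ∑ i, Bool.toNat (s i))) : ℝ))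
        * (∑ s : Fin n → Bool, (∏ i, (if s i then p i else 1 - p i))
            * (Bool.toNat (B s && decide (t ≤ ∑ i, Bool.toNat (s i))) : ℝ)) :=
  F_nonneg_of_eq_threshold n t p hp0 hp1 A B (fun s => decide (t ≤ ∑ i, Bool.toNat (s i))) hA hB rfl

end SahiFComb

end Summit.CriticalPhenomena.PercolationContinuityZ3.Theorems
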